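import Literature.Geometry.ComplexHyperbolic.UnitBallQuotientManifold
import HarnessLib

/-!
# Proper discontinuity on the ball `𝔹²` ⟺ finiteness of the corner entries `‖δ₂₂‖ ≤ R`

Continuation of `UnitBallBounds.lean` / `UnitBallQuotientManifold.lean` (the tree's affine ball model
`BallModel.Ball = 𝔹² ⊂ ℂ²` with the fractional-linear action of `U(2,1) = BallModel.U21`, `J = diag(1,1,-1)`).

For a subgroup `Δ ≤ U(2,1)` the following are equivalent, and this file PROVES the equivalence:

* `Δ` acts PROPERLY DISCONTINUOUSLY on `𝔹²` (Mathlib's `ProperlyDiscontinuousSMul Δ Ball`: for compact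
  `K, L ⊆ 𝔹²` only finitely many `δ` have `δ K ∩ L ≠ ∅`);
* **corner finiteness**: for every real `R` only finitely many `δ ∈ Δ` have corner entry `‖δ₂₂‖ ≤ R`
  (`finite_setOf_norm_22_le_of_properlyDiscontinuousSMul`, converse
  `properlyDiscontinuousSMul_of_finite_norm_22_le`, packaged as
  `properlyDiscontinuousSMul_iff_finite_norm_22_le`).

The direction «corner finiteness ⇒ proper discontinuity» is the tree's
`BallModel.properlyDiscontinuousSMul_of_finite` + `exists_norm_entry_le_of_isCompact` (two-point bound); the
direction proved here, «proper discontinuity ⇒ corner finiteness», takes `K = {0}` and `L` = the closed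
sub-ball `{|z|² ≤ 1 - R⁻²}` (compact: `isCompact_setOf_nsq_le`) and uses the identity
`1 - |δ·0|² = ‖δ₂₂‖⁻²` (`one_sub_nsq_smul_x₀`): `‖δ₂₂‖ ≤ R ⇒ δ·0 ∈ L`.

Corner finiteness `∀ R, {γ | ‖(ρ γ)₂₂‖ ≤ R}.Finite` is the discreteness hypothesis `hρ` under which the
tree's Poincaré series on `𝔹²` converge (`ShimuraVarieties/UnitaryBallPoincareSeries.lean`,
`BallPoincare.summable_norm_poincareTerm` etc., for any `ρ : G →* U(2,1)`); the lemmas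
`finite_setOf_norm_22_subtype_le` / `forall_subtype_smul_eq_imp` / `subtype_smul_ne_of_mk_ne` below spell
the three hypotheses of that theory (`hρ`, freeness `hfree`, distinct orbits `h12`) for `ρ := Δ.subtype` in
terms of the instance binders `[ProperlyDiscontinuousSMul Δ Ball] [IsCancelSMul Δ Ball]` and the quotient
manifold `Δ\𝔹² = orbitRel.Quotient Δ Ball` of `UnitBallQuotientManifold.lean`, so that statements proved
over `ρ.range` apply to a discontinuous torsion-free `Δ` verbatim (`Δ.subtype.range = Δ`,
Mathlib `Subgroup.range_subtype`).

References: A. Borel, *Introduction aux groupes arithmétiques* (1969), §1 and Prop. 7.13 (discrete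
subgroups act properly discontinuously on `G/K`); W. Rudin, *Function Theory in the Unit Ball of ℂⁿ* (1980),
Thm 2.2.2 (the automorphisms `φ_a`, `1 - |φ_a(0)|²`); I. R. Shafarevich, *Basic Algebraic Geometry 2*,
Ch. IX §3.1 (discrete groups of automorphisms of bounded domains). Everything below is PROVED. [folklore]

Not here: cocompactness, arithmetic examples (those are
`UnitaryGroupCongruenceDiscontinuous.lean`, where the arithmetic instance of corner finiteness is
`UnitaryGroup.finite_setOf_norm_22_archRepU21_le`).
-/

set_option autoImplicit false

noncomputable section

open Set Function MulAction Topology Matrix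

-- build-enqueue re-land 2026-08-21 (ops-buildfix-2 gen 9): no content change; the first lake build of this module was a victim of lane batch 28 (rc 75, host timeout).
namespace Literature.Geometry.ComplexHyperbolic

namespace BallModel

/-! ### Compact sub-balls -/

/-- On the closed sub-ball `|z|² ≤ 1 - ε` (`ε > 0`) every coordinate has norm `≤ 1`. [folklore] -/
private theorem norm_apply_le_one_of_nsq_le {ε : ℝ} (hε : 0 < ε) {w : Fin 2 → ℂ}
    (hw : nsq w ≤ 1 - ε) (i : Fin 2) : ‖w i‖ ≤ 1 := by
  have h0 : ‖w 0‖ ^ 2 ≤ 1 := by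
    unfold nsq at hw; nlinarith [sq_nonneg ‖w 1‖]
  have h1 : ‖w 1‖ ^ 2 ≤ 1 := by
    unfold nsq at hw; nlinarith [sq_nonneg ‖w 0‖]
  fin_cases i
  · exact (sq_le_one_iff₀ (norm_nonneg _)).1 h0
  · exact (sq_le_one_iff₀ (norm_nonneg _)).1 h1

/-- **The closed sub-balls are compact**: for `ε > 0` the set `{z ∈ 𝔹² : |z|² ≤ 1 - ε}` is a compact
subset of the (open) ball — it is a closed bounded subset of `ℂ²` contained in `𝔹²`, and `𝔹² ⊂ ℂ²` is an
embedding (the compact exhaustion of a bounded domain by closed sub-domains).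
[cite: Shafarevich1994, Ch. IX §3.1] -/
theorem isCompact_setOf_nsq_le {ε : ℝ} (hε : 0 < ε) : IsCompact {z : Ball | nsq z.1 ≤ 1 - ε} := by
  rw [isOpenEmbedding_coe.toIsEmbedding.isCompact_iff]
  have himg : (fun z : Ball ↦ (z.1 : Fin 2 → ℂ)) '' {z : Ball | nsq z.1 ≤ 1 - ε} =
      {w : Fin 2 → ℂ | nsq w ≤ 1 - ε} := by
    ext w
    constructor
    · rintro ⟨z, hz, rfl⟩
      exact hz
    · intro hw
      exact ⟨⟨w, by simp only [mem_setOf_eq] at hw; linarith⟩, hw, rfl⟩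
  rw [himg]
  refine Metric.isCompact_of_isClosed_isBounded (isClosed_le continuous_fun_nsq continuous_const) ?_
  refine (Metric.isBounded_closedBall (x := (0 : Fin 2 → ℂ)) (r := 1)).subset fun w hw ↦ ?_
  rw [Metric.mem_closedBall, dist_zero_right, pi_norm_le_iff_of_nonneg zero_le_one]
  exact norm_apply_le_one_of_nsq_le hε hw

/-- `‖δ₂₂‖ ≤ R` puts `δ·0` in the closed sub-ball `|z|² ≤ 1 - R⁻²`
(`1 - |δ·0|² = ‖δ₂₂‖⁻² ≥ R⁻²`; here necessarily `R ≥ 1`). [cite: Rudin1980, Thm 2.2.2] -/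
theorem nsq_smul_x₀_le_of_norm_22_le {g : U21} {R : ℝ} (h : ‖mat g 2 2‖ ≤ R) :
    nsq (g • x₀).1 ≤ 1 - 1 / R ^ 2 := by
  have hid := one_sub_nsq_smul_x₀ g
  have hpos : 0 < ‖mat g 2 2‖ := norm_22_pos g
  have hle : 1 / R ^ 2 ≤ 1 / ‖mat g 2 2‖ ^ 2 :=
    one_div_le_one_div_of_le (pow_pos hpos 2) (pow_le_pow_left₀ (norm_nonneg _) h 2)
  linarith

/-! ### Proper discontinuity versus corner finiteness -/

section Subgroup

variable (Δ : Subgroup U21)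

/-- **Proper discontinuity ⇒ corner finiteness.** If `Δ ≤ U(2,1)` acts properly discontinuously on
`𝔹²`, then for every `R` only finitely many `δ ∈ Δ` have `‖δ₂₂‖ ≤ R`: such `δ` move the origin into the
compact sub-ball `|z|² ≤ 1 - R⁻²`. [cite: Borel1969, Prop. 7.13] -/
theorem finite_setOf_norm_22_le_of_properlyDiscontinuousSMul [ProperlyDiscontinuousSMul Δ Ball] (R : ℝ) :
    {δ : Δ | ‖mat (δ : U21) 2 2‖ ≤ R}.Finite := by
  rcases le_or_gt R 0 with hR | hR
  · refine Set.finite_empty.subset fun δ hδ ↦ ?_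
    have h1 : (1 : ℝ) ≤ R := (one_le_norm_22 (δ : U21)).trans hδ
    exact absurd (h1.trans hR) (by norm_num)
  · have hfin := ProperlyDiscontinuousSMul.finite_disjoint_inter_image (Γ := Δ) (T := Ball)
      (K := {x₀}) (L := {z : Ball | nsq z.1 ≤ 1 - 1 / R ^ 2}) isCompact_singleton
      (isCompact_setOf_nsq_le (by positivity))
    refine hfin.subset fun δ hδ ↦ ?_
    have hmem : δ • x₀ ∈ {z : Ball | nsq z.1 ≤ 1 - 1 / R ^ 2} := by
      rw [mem_setOf_eq, Subgroup.smul_def]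
      exact nsq_smul_x₀_le_of_norm_22_le hδ
    rw [mem_setOf_eq, image_singleton]
    exact ⟨δ • x₀, mem_singleton _, hmem⟩

/-- **Corner finiteness ⇒ proper discontinuity** (the tree's constructor
`properlyDiscontinuousSMul_of_finite` fed by the compact two-point bound
`exists_norm_entry_le_of_isCompact`). [cite: Borel1969, Prop. 7.13] -/
theorem properlyDiscontinuousSMul_of_finite_norm_22_le
    (h : ∀ R : ℝ, {δ : Δ | ‖mat (δ : U21) 2 2‖ ≤ R}.Finite) : ProperlyDiscontinuousSMul Δ Ball :=
  properlyDiscontinuousSMul_of_finite Δ fun _ _ hK hL ↦ by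
    obtain ⟨R, hR⟩ := exists_norm_entry_le_of_isCompact hK hL
    exact (h R).subset fun δ ⟨z, hz, hδz⟩ ↦ hR (δ : U21) z hz hδz 2 2

/-- **Proper discontinuity on `𝔹²` ⟺ corner finiteness** for a subgroup `Δ ≤ U(2,1)`.
[cite: Borel1969, Prop. 7.13] -/
theorem properlyDiscontinuousSMul_iff_finite_norm_22_le :
    ProperlyDiscontinuousSMul Δ Ball ↔ ∀ R : ℝ, {δ : Δ | ‖mat (δ : U21) 2 2‖ ≤ R}.Finite :=
  ⟨fun _ R ↦ finite_setOf_norm_22_le_of_properlyDiscontinuousSMul Δ R,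
    properlyDiscontinuousSMul_of_finite_norm_22_le Δ⟩

/-- Corner finiteness implies **entry finiteness**: only finitely many `δ ∈ Δ` have all entries of
norm `≤ R` (trivially, the corner being one of the entries); conversely entry finiteness implies corner
finiteness because every entry is dominated by the corner (`norm_entry_le_norm_22`). [cite: Borel1969, §1] -/
theorem finite_setOf_norm_entry_le_iff_finite_norm_22_le :
    (∀ R : ℝ, {δ : Δ | ∀ i j, ‖mat (δ : U21) i j‖ ≤ R}.Finite) ↔
      ∀ R : ℝ, {δ : Δ | ‖mat (δ : U21) 2 2‖ ≤ R}.Finite := by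
  constructor
  · intro h R
    exact (h R).subset fun δ hδ i j ↦ (norm_entry_le_norm_22 (δ : U21) i j).trans hδ
  · intro h R
    exact (h R).subset fun δ hδ ↦ hδ 2 2

/-- A properly discontinuous `Δ ≤ U(2,1)` has only finitely many elements with all entries of norm
`≤ R`. [cite: Borel1969, Prop. 7.13] -/
theorem finite_setOf_norm_entry_le_of_properlyDiscontinuousSMul [ProperlyDiscontinuousSMul Δ Ball]
    (R : ℝ) : {δ : Δ | ∀ i j, ‖mat (δ : U21) i j‖ ≤ R}.Finite :=
  (finite_setOf_norm_entry_le_iff_finite_norm_22_le Δ).2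
    (finite_setOf_norm_22_le_of_properlyDiscontinuousSMul Δ) R

/-! ### The hypotheses of the Poincaré-series theory for `ρ := Δ.subtype` -/

/-- **`hρ` for the inclusion `Δ.subtype : Δ →* U(2,1)`**: a properly discontinuous `Δ` satisfies the
corner-finiteness hypothesis of `ShimuraVarieties/UnitaryBallPoincareSeries.lean` for the representation
`ρ := Δ.subtype`. [cite: Borel1969, Prop. 7.13] -/
theorem finite_setOf_norm_22_subtype_le [ProperlyDiscontinuousSMul Δ Ball] (R : ℝ) :
    {δ : Δ | ‖mat (Δ.subtype δ) 2 2‖ ≤ R}.Finite :=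
  finite_setOf_norm_22_le_of_properlyDiscontinuousSMul Δ R

/-- **Freeness from cancellativity**: if the action of `Δ` on `𝔹²` is cancellative (`IsCancelSMul`,
Mathlib's spelling of a free action), no `δ ≠ 1` fixes a point. Converse of the tree's
`isCancelSMul_of_smul_eq_imp`. [cite: Lee2012, Ch. 21, free actions (p. 541)] -/
theorem eq_one_of_smul_eq [IsCancelSMul Δ Ball] {δ : Δ} {z : Ball} (h : δ • z = z) : δ = 1 :=
  IsCancelSMul.eq_one_of_smul h

/-- Freeness ⟺ cancellativity for `Δ ≤ U(2,1)` acting on `𝔹²`.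
[cite: Lee2012, Ch. 21, free actions (p. 541)] -/
theorem isCancelSMul_iff_forall_smul_eq_imp :
    IsCancelSMul Δ Ball ↔ ∀ (δ : Δ) (z : Ball), δ • z = z → δ = 1 :=
  ⟨fun _ _ _ h ↦ eq_one_of_smul_eq Δ h, isCancelSMul_of_smul_eq_imp Δ⟩

/-- **`hfree` for `ρ := Δ.subtype`**: `Δ.subtype δ • z = z → δ = 1` for a cancellative (free) action.
[cite: Lee2012, Ch. 21, free actions (p. 541)] -/
theorem forall_subtype_smul_eq_imp [IsCancelSMul Δ Ball] :
    ∀ (δ : Δ) (z : Ball), Δ.subtype δ • z = z → δ = 1 :=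
  fun _ _ h ↦ eq_one_of_smul_eq Δ h

/-- Two points of `𝔹²` have the same image in `Δ\𝔹²` iff some `δ ∈ Δ` carries the first to the
second (no discontinuity or freeness needed) — the definition of the orbit space.
[cite: Lee2012, Ch. 21, orbit spaces (p. 541)] -/
theorem mk_eq_mk_iff_exists_smul_eq (z₁ z₂ : Ball) :
    Literature.Geometry.Manifold.QuotientManifold.mk (G := Δ) z₁ =
        Literature.Geometry.Manifold.QuotientManifold.mk (G := Δ) z₂ ↔
      ∃ δ : Δ, δ • z₁ = z₂ := by
  constructor
  · intro h
    obtain ⟨δ, hδ⟩ := MulAction.mem_orbit_iff.1 (MulAction.orbitRel_apply.1 (Quotient.exact h))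
    exact ⟨δ⁻¹, by rw [← hδ, inv_smul_smul]⟩
  · rintro ⟨δ, hδ⟩
    exact Quotient.sound (MulAction.orbitRel_apply.2 (MulAction.mem_orbit_iff.2
      ⟨δ⁻¹, by rw [← hδ, inv_smul_smul]⟩))

/-- The same with the `U(2,1)`-action of `Δ.subtype δ` (the shape of the Poincaré-series files).
[cite: Lee2012, Ch. 21, orbit spaces (p. 541)] -/
theorem mk_eq_mk_iff_exists_subtype_smul_eq (z₁ z₂ : Ball) :
    Literature.Geometry.Manifold.QuotientManifold.mk (G := Δ) z₁ =
        Literature.Geometry.Manifold.QuotientManifold.mk (G := Δ) z₂ ↔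
      ∃ δ : Δ, Δ.subtype δ • z₁ = z₂ :=
  mk_eq_mk_iff_exists_smul_eq Δ z₁ z₂

/-- **`h12` for `ρ := Δ.subtype`**: points with different images in the quotient `Δ\𝔹²` lie in different
`Δ`-orbits, `Δ.subtype δ • z₁ ≠ z₂` for all `δ`. [cite: Lee2012, Ch. 21, orbit spaces (p. 541)] -/
theorem subtype_smul_ne_of_mk_ne {z₁ z₂ : Ball}
    (h : Literature.Geometry.Manifold.QuotientManifold.mk (G := Δ) z₁ ≠
      Literature.Geometry.Manifold.QuotientManifold.mk (G := Δ) z₂) (δ : Δ) :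
    Δ.subtype δ • z₁ ≠ z₂ :=
  fun hδ ↦ h ((mk_eq_mk_iff_exists_subtype_smul_eq Δ z₁ z₂).2 ⟨δ, hδ⟩)

/-- Conversely, points in different `Δ`-orbits have different images in `Δ\𝔹²`.
[cite: Lee2012, Ch. 21, orbit spaces (p. 541)] -/
theorem mk_ne_mk_of_forall_subtype_smul_ne {z₁ z₂ : Ball} (h : ∀ δ : Δ, Δ.subtype δ • z₁ ≠ z₂) :
    Literature.Geometry.Manifold.QuotientManifold.mk (G := Δ) z₁ ≠
      Literature.Geometry.Manifold.QuotientManifold.mk (G := Δ) z₂ :=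
  fun hq ↦ by
    obtain ⟨δ, hδ⟩ := (mk_eq_mk_iff_exists_subtype_smul_eq Δ z₁ z₂).1 hq
    exact h δ hδ

end Subgroup

end BallModel

end Literature.Geometry.ComplexHyperbolic

end
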